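import Summits.CriticalPhenomena.PercolationContinuityZ3.Theorems.PercNearOneGluingNoHeavyLowerTailSahiGridPatternReduceTop

/-!
# `NoHeavyLowerTail` (crux stmt-CriticalPhenomena-4575), Sahi programme: **COMB-M⁺ FOR ANTICHAIN INCREMENTS — every dimension, given the pattern
# inequality one dimension down** (the R / R′ reductions of `…Reduce`, `…ReduceTop` run to the end)

Support file (seat `prim-ineq-gen-4`, generation 14; `--supports stmt-CriticalPhenomena-4575`).  Pure proofs, no definitions, no `sorry`, standard axioms.

THE MATHEMATICS.  An upper-step triple of up-sets `Au, Bu, Cu ⊆ [3]^{n+1}` (level-`1` slice = level-`2` slice) has INCREMENTS `a = A² ∖ A⁰`, `b`, `c` (top slice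
minus bottom slice).  **THEOREM (`two_mul_sStarD_top_le_of_antichain_increments`): if `a`, `b`, `c` are ANTICHAINS (no two comparable points; e.g. each bottom slice is
the top slice minus some of its MINIMAL elements) and `PatternPos n` holds (as the hypothesis `hP`; unconditional for `n ≤ 3`), then top-slice dominance holds:
`2·sStarD(A²,B²,C²) ≤ sStarD Au Bu Cu`** (cube: `c₂ ≥ c₃`).  PROOF: induction on `#a + #b + #c`.  If all increments are empty the three sets are cylinders and
`sStarD υ = 6·sStarD τ ≥ 2·sStarD τ` (`two_mul_sStarD_top_le_of_upperStep_twoCylinders`).  Otherwise pick `w` in a nonempty increment, say `a` (slots are permuted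
with `sStarD_swap12/23`).  If `(w,0) ∉ Bu ∩ Cu`, THEOREM R (`sStarD_insert_bottom_le`) says that adding `(w,0)` to `Au` does not increase `sStarD`; the new set is an
up-set because `w` is MAXIMAL in the antichain `a`, and its increment is `a ∖ w`.  If `(w,0) ∈ Bu ∩ Cu` then `w ∈ B² ∩ C²` and THEOREM R′ (`slack_erase_top_le`) says that
deleting `(w,1),(w,2)` from `Au` does not increase the slack `sStarD υ − 2·sStarD τ`; the new set is an up-set because `w` is MINIMAL in `A²` (antichain again), its
increment is `a ∖ w`.  Either way the induction hypothesis finishes.  This is the first face of COMB-M⁺ defined by the SHAPE of the increments (one layer per slot),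
with all three slots moving and no density condition.  Memo: `run/shared/lean/prim/prim-ineq-gen-4/FINDING-W-FORM-g14.md` (R′).
HONEST LABEL: COMB-M⁺ in general, `PatternPos d` (`d ≥ 4`), Sahi's `C₃` and Kahn's conjecture remain OPEN; nothing here asserts them. [this work]
-/

namespace Summit.CriticalPhenomena.PercolationContinuityZ3.Theorems.SahiGridPattern

open Finset SahiGrid3
open scoped BigOperators

variable {n : ℕ}

/-- Order between `snoc` points. [this work] -/
theorem snoc_le_snoc_iff' (p q : Pd n) (i j : Fin 3) :
    (Fin.snoc p i : Pd (n + 1)) ≤ Fin.snoc q j ↔ (p ≤ q ∧ i ≤ j) := by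
  constructor
  · intro h
    refine ⟨fun a => ?_, ?_⟩
    · have := h (Fin.castSucc a); simpa [Fin.snoc_castSucc] using this
    · have := h (Fin.last n); simpa [Fin.snoc_last] using this
  · rintro ⟨h1, h2⟩ a
    refine Fin.lastCases ?_ (fun b => ?_) a
    · simpa [Fin.snoc_last] using h2
    · simpa [Fin.snoc_castSucc] using h1 b

/-- Distinct levels give distinct `snoc` points. [this work] -/
theorem snoc_ne_snoc_of_ne (p q : Pd n) {i j : Fin 3} (hij : i ≠ j) : (Fin.snoc p i : Pd (n + 1)) ≠ Fin.snoc q j := fun h => by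
  have := congrFun h (Fin.last n); simp only [Fin.snoc_last] at this; exact hij this

/-- Equal `snoc` points have equal initial parts. [this work] -/
theorem eq_of_snoc_eq (p q : Pd n) {i j : Fin 3} (h : (Fin.snoc p i : Pd (n + 1)) = Fin.snoc q j) : p = q := by
  funext a; have := congrFun h (Fin.castSucc a); simpa [Fin.snoc_castSucc] using this

/-! ### Slices of the two one-point modifications -/

/-- Top slice after adding a bottom point. [this work] -/
theorem filter_two_insert_bottom (Au : Finset (Pd (n + 1))) (w : Pd n) :
    (univ.filter fun q : Pd n => (Fin.snoc q 2 : Pd (n + 1)) ∈ (insert (Fin.snoc w 0 : Pd (n + 1)) Au)) = (univ.filter fun q : Pd n => (Fin.snoc q 2 : Pd (n + 1)) ∈ Au) := by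
  ext q; simp only [mem_filter, mem_univ, true_and, mem_insert, snoc_ne_snoc_of_ne q w (by decide : (2:Fin 3) ≠ 0), false_or]

/-- Bottom slice after adding a bottom point. [this work] -/
theorem filter_zero_insert_bottom (Au : Finset (Pd (n + 1))) (w : Pd n) :
    (univ.filter fun q : Pd n => (Fin.snoc q 0 : Pd (n + 1)) ∈ (insert (Fin.snoc w 0 : Pd (n + 1)) Au)) = insert w (univ.filter fun q : Pd n => (Fin.snoc q 0 : Pd (n + 1)) ∈ Au) := by
  ext q; simp only [mem_filter, mem_univ, true_and, mem_insert]
  constructor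
  · rintro (h | h)
    · exact Or.inl (eq_of_snoc_eq q w h)
    · exact Or.inr h
  · rintro (h | h)
    · exact Or.inl (by rw [h])
    · exact Or.inr h

/-- Top slice after deleting a top point. [this work] -/
theorem filter_two_erase_top (Au : Finset (Pd (n + 1))) (w : Pd n) :
    (univ.filter fun q : Pd n => (Fin.snoc q 2 : Pd (n + 1)) ∈ ((Au.erase (Fin.snoc w 1 : Pd (n + 1))).erase (Fin.snoc w 2 : Pd (n + 1)))) = ((univ.filter fun q : Pd n => (Fin.snoc q 2 : Pd (n + 1)) ∈ Au)).erase w := by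
  ext q
  simp only [mem_filter, mem_univ, true_and, Finset.mem_erase]
  constructor
  · rintro ⟨h1, _, h3⟩; exact ⟨fun h => h1 (by rw [h]), h3⟩
  · rintro ⟨h1, h2⟩; exact ⟨fun h => h1 (eq_of_snoc_eq q w h), snoc_ne_snoc_of_ne q w (by decide : (2:Fin 3) ≠ 1), h2⟩

/-- Bottom slice after deleting a top point. [this work] -/
theorem filter_zero_erase_top (Au : Finset (Pd (n + 1))) (w : Pd n) :
    (univ.filter fun q : Pd n => (Fin.snoc q 0 : Pd (n + 1)) ∈ ((Au.erase (Fin.snoc w 1 : Pd (n + 1))).erase (Fin.snoc w 2 : Pd (n + 1)))) = (univ.filter fun q : Pd n => (Fin.snoc q 0 : Pd (n + 1)) ∈ Au) := by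
  ext q
  simp only [mem_filter, mem_univ, true_and, Finset.mem_erase]
  constructor
  · rintro ⟨_, _, h3⟩; exact h3
  · intro h; exact ⟨snoc_ne_snoc_of_ne q w (by decide : (0:Fin 3) ≠ 2), snoc_ne_snoc_of_ne q w (by decide : (0:Fin 3) ≠ 1), h⟩

/-- Adding a bottom point keeps the upper-step property. [this work] -/
theorem upperStep_insert_bottom (Au : Finset (Pd (n + 1))) (w : Pd n) (hAu : (∀ q : Pd n, ind Au (Fin.snoc q 1 : Pd (n + 1)) = ind Au (Fin.snoc q 2 : Pd (n + 1)))) :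
    (∀ q : Pd n, ind (insert (Fin.snoc w 0 : Pd (n + 1)) Au) (Fin.snoc q 1 : Pd (n + 1)) = ind (insert (Fin.snoc w 0 : Pd (n + 1)) Au) (Fin.snoc q 2 : Pd (n + 1))) := by
  intro q; have h := hAu q; unfold ind at h ⊢
  simp only [mem_insert, snoc_ne_snoc_of_ne q w (by decide : (1:Fin 3) ≠ 0), snoc_ne_snoc_of_ne q w (by decide : (2:Fin 3) ≠ 0), false_or]
  exact h

/-- Deleting a top point (both upper levels) keeps the upper-step property. [this work] -/
theorem upperStep_erase_top (Au : Finset (Pd (n + 1))) (w : Pd n) (hAu : (∀ q : Pd n, ind Au (Fin.snoc q 1 : Pd (n + 1)) = ind Au (Fin.snoc q 2 : Pd (n + 1)))) :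
    (∀ q : Pd n, ind ((Au.erase (Fin.snoc w 1 : Pd (n + 1))).erase (Fin.snoc w 2 : Pd (n + 1))) (Fin.snoc q 1 : Pd (n + 1)) = ind ((Au.erase (Fin.snoc w 1 : Pd (n + 1))).erase (Fin.snoc w 2 : Pd (n + 1))) (Fin.snoc q 2 : Pd (n + 1))) := by
  intro q; have h := hAu q; unfold ind at h ⊢
  by_cases hq : q = w
  · subst hq
    rw [if_neg (fun h' => (Finset.mem_erase.1 (Finset.mem_erase.1 h').2).1 rfl), if_neg (fun h' => (Finset.mem_erase.1 h').1 rfl)]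
  · have h1 : (Fin.snoc q 1 : Pd (n + 1)) ≠ Fin.snoc w 1 := fun h' => hq (eq_of_snoc_eq q w h')
    have h2' : (Fin.snoc q 2 : Pd (n + 1)) ≠ Fin.snoc w 2 := fun h' => hq (eq_of_snoc_eq q w h')
    have m1 : ((Fin.snoc q 1 : Pd (n + 1)) ∈ ((Au.erase (Fin.snoc w 1 : Pd (n + 1))).erase (Fin.snoc w 2 : Pd (n + 1)))) ↔ ((Fin.snoc q 1 : Pd (n + 1)) ∈ Au) := by
      simp only [Finset.mem_erase, snoc_ne_snoc_of_ne q w (by decide : (1:Fin 3) ≠ 2), h1, ne_eq, not_false_eq_true, true_and]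
    have m2 : ((Fin.snoc q 2 : Pd (n + 1)) ∈ ((Au.erase (Fin.snoc w 1 : Pd (n + 1))).erase (Fin.snoc w 2 : Pd (n + 1)))) ↔ ((Fin.snoc q 2 : Pd (n + 1)) ∈ Au) := by
      simp only [Finset.mem_erase, h2', snoc_ne_snoc_of_ne q w (by decide : (2:Fin 3) ≠ 1), ne_eq, not_false_eq_true, true_and]
    simp only [m1, m2]; exact h

/-- Adding `(w,0)` to an upper-step up-set keeps it an up-set when `w` lies in the top slice and every top point strictly above `w` is a bottom point. [this work] -/
theorem isUpperSet_insert_bottom (Au : Finset (Pd (n + 1))) (w : Pd n) (hA : IsUpperSet (((Au : Finset (Pd (n + 1)))) : Set (Pd (n + 1)))) (hAu : (∀ q : Pd n, ind Au (Fin.snoc q 1 : Pd (n + 1)) = ind Au (Fin.snoc q 2 : Pd (n + 1))))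
    (hw2 : (Fin.snoc w 2 : Pd (n + 1)) ∈ Au)
    (hmax : ∀ q : Pd n, w ≤ q → q ≠ w → (Fin.snoc q 2 : Pd (n + 1)) ∈ Au → (Fin.snoc q 0 : Pd (n + 1)) ∈ Au) :
    IsUpperSet ((((insert (Fin.snoc w 0 : Pd (n + 1)) Au) : Finset (Pd (n + 1)))) : Set (Pd (n + 1))) := by
  intro x y hxy hx
  rw [Finset.mem_coe, mem_insert] at hx ⊢
  rcases hx with hx | hx
  · -- x = (w,0) ≤ y
    subst hx
    have ey : y = Fin.snoc (Fin.init y) (y (Fin.last n)) := (Fin.snoc_init_self y).symm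
    rw [ey] at hxy ⊢
    rcases (snoc_le_snoc_iff' w (Fin.init y) 0 (y (Fin.last n))).1 hxy with ⟨hwq, _⟩
    have hw1 : (Fin.snoc w 1 : Pd (n + 1)) ∈ Au := by
      have := hAu w; unfold ind at this; rw [if_pos hw2] at this
      by_contra h; rw [if_neg h] at this; exact absurd this (by norm_num)
    by_cases hq : Fin.init y = w
    · rw [hq]
      -- (w, j) for j = 0,1,2
      have hj : y (Fin.last n) = 0 ∨ y (Fin.last n) = 1 ∨ y (Fin.last n) = 2 := by
        rcases (y (Fin.last n)) with ⟨v, hv⟩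
        rcases v with _ | v; · exact Or.inl rfl
        rcases v with _ | v; · exact Or.inr (Or.inl rfl)
        rcases v with _ | v; · exact Or.inr (Or.inr rfl)
        omega
      rcases hj with hj | hj | hj
      · left; rw [hj]
      · right; rw [hj]; exact hw1
      · right; rw [hj]; exact hw2
    · right
      have hq2 : (Fin.snoc (Fin.init y) 2 : Pd (n + 1)) ∈ Au := hA (snoc_le_snoc_of_le_left hwq 2) hw2
      have hq0 : (Fin.snoc (Fin.init y) 0 : Pd (n + 1)) ∈ Au := hmax (Fin.init y) hwq hq hq2
      exact hA (snoc_le_snoc_of_le (Fin.init y) (Fin.zero_le _)) hq0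
  · right; exact hA hxy hx

/-- Deleting `(w,1),(w,2)` from an upper-step up-set keeps it an up-set when `(w,0)` is not in it and every top point strictly below `w` is a bottom point. [this work] -/
theorem isUpperSet_erase_top (Au : Finset (Pd (n + 1))) (w : Pd n) (hA : IsUpperSet (((Au : Finset (Pd (n + 1)))) : Set (Pd (n + 1))))
    (hw0 : (Fin.snoc w 0 : Pd (n + 1)) ∉ Au)
    (hmin : ∀ q : Pd n, q ≤ w → q ≠ w → (Fin.snoc q 2 : Pd (n + 1)) ∈ Au → (Fin.snoc q 0 : Pd (n + 1)) ∈ Au) :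
    IsUpperSet (((((Au.erase (Fin.snoc w 1 : Pd (n + 1))).erase (Fin.snoc w 2 : Pd (n + 1))) : Finset (Pd (n + 1)))) : Set (Pd (n + 1))) := by
  intro x y hxy hx
  rw [Finset.mem_coe, Finset.mem_erase, Finset.mem_erase] at hx ⊢
  obtain ⟨hx2, hx1, hxA⟩ := hx
  have hyA : y ∈ Au := hA hxy hxA
  -- if y were (w,1) or (w,2) we derive (w,0) ∈ Au
  have key : ∀ j : Fin 3, y = Fin.snoc w j → False := by
    intro j hyj
    have ex : x = Fin.snoc (Fin.init x) (x (Fin.last n)) := (Fin.snoc_init_self x).symm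
    rw [hyj, ex] at hxy
    rcases (snoc_le_snoc_iff' (Fin.init x) w (x (Fin.last n)) j).1 hxy with ⟨hqw, _⟩
    by_cases hq : Fin.init x = w
    · -- x = (w, i): i = 0 contradicts hw0, i = 1,2 contradict hx1, hx2
      have hi : x (Fin.last n) = 0 ∨ x (Fin.last n) = 1 ∨ x (Fin.last n) = 2 := by
        rcases (x (Fin.last n)) with ⟨v, hv⟩
        rcases v with _ | v; · exact Or.inl rfl
        rcases v with _ | v; · exact Or.inr (Or.inl rfl)
        rcases v with _ | v; · exact Or.inr (Or.inr rfl)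
        omega
      rcases hi with hi | hi | hi
      · apply hw0; rw [← hq, ← hi, ← ex]; exact hxA
      · apply hx1; rw [ex, hq, hi]
      · apply hx2; rw [ex, hq, hi]
    · have hq2 : (Fin.snoc (Fin.init x) 2 : Pd (n + 1)) ∈ Au := by
        have hxle : x ≤ (Fin.snoc (Fin.init x) 2 : Pd (n + 1)) := by
          intro a
          refine Fin.lastCases ?_ (fun b => ?_) a
          · rw [Fin.snoc_last, Fin.le_iff_val_le_val, Fin.val_two]; have h3 := (x (Fin.last n)).isLt; omega
          · rw [Fin.snoc_castSucc]; exact le_rfl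
        exact hA hxle hxA
      have hq0 := hmin (Fin.init x) hqw hq hq2
      exact hw0 (hA (snoc_le_snoc_of_le_left hqw 0) hq0)
  refine ⟨fun h => key 2 h, fun h => key 1 h, hyA⟩

/-- **COMB-M⁺ FOR ANTICHAIN INCREMENTS** (every `n`; induction on the total increment size).  Given `PatternPos n` (hypothesis `hP`): for every upper-step
triple of up-sets `Au, Bu, Cu ⊆ [3]^{n+1}` whose three increments `A²∖A⁰, B²∖B⁰, C²∖C⁰` are antichains, `2·sStarD(A²,B²,C²) ≤ sStarD Au Bu Cu`. [this work] -/
theorem two_mul_sStarD_top_le_of_antichain_increments (hP : ∀ X Y Z : Finset (Pd n), IsUpperSet (X : Set (Pd n)) → IsUpperSet (Y : Set (Pd n)) → IsUpperSet (Z : Set (Pd n)) → 0 ≤ sStarD X Y Z) (k : ℕ) :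
    ∀ Au Bu Cu : Finset (Pd (n + 1)), IsUpperSet (((Au : Finset (Pd (n + 1)))) : Set (Pd (n + 1))) → IsUpperSet (((Bu : Finset (Pd (n + 1)))) : Set (Pd (n + 1))) → IsUpperSet (((Cu : Finset (Pd (n + 1)))) : Set (Pd (n + 1))) → (∀ q : Pd n, ind Au (Fin.snoc q 1 : Pd (n + 1)) = ind Au (Fin.snoc q 2 : Pd (n + 1))) → (∀ q : Pd n, ind Bu (Fin.snoc q 1 : Pd (n + 1)) = ind Bu (Fin.snoc q 2 : Pd (n + 1))) → (∀ q : Pd n, ind Cu (Fin.snoc q 1 : Pd (n + 1)) = ind Cu (Fin.snoc q 2 : Pd (n + 1))) →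
      (∀ p ∈ ((univ.filter fun q : Pd n => (Fin.snoc q 2 : Pd (n + 1)) ∈ Au) \ (univ.filter fun q : Pd n => (Fin.snoc q 0 : Pd (n + 1)) ∈ Au)), ∀ q ∈ ((univ.filter fun q : Pd n => (Fin.snoc q 2 : Pd (n + 1)) ∈ Au) \ (univ.filter fun q : Pd n => (Fin.snoc q 0 : Pd (n + 1)) ∈ Au)), p ≤ q → p = q) → (∀ p ∈ ((univ.filter fun q : Pd n => (Fin.snoc q 2 : Pd (n + 1)) ∈ Bu) \ (univ.filter fun q : Pd n => (Fin.snoc q 0 : Pd (n + 1)) ∈ Bu)), ∀ q ∈ ((univ.filter fun q : Pd n => (Fin.snoc q 2 : Pd (n + 1)) ∈ Bu) \ (univ.filter fun q : Pd n => (Fin.snoc q 0 : Pd (n + 1)) ∈ Bu)), p ≤ q → p = q) → (∀ p ∈ ((univ.filter fun q : Pd n => (Fin.snoc q 2 : Pd (n + 1)) ∈ Cu) \ (univ.filter fun q : Pd n => (Fin.snoc q 0 : Pd (n + 1)) ∈ Cu)), ∀ q ∈ ((univ.filter fun q : Pd n => (Fin.snoc q 2 : Pd (n + 1)) ∈ Cu)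 \ (univ.filter fun q : Pd n => (Fin.snoc q 0 : Pd (n + 1)) ∈ Cu)), p ≤ q → p = q) →
      (((univ.filter fun q : Pd n => (Fin.snoc q 2 : Pd (n + 1)) ∈ Au) \ (univ.filter fun q : Pd n => (Fin.snoc q 0 : Pd (n + 1)) ∈ Au)).card + ((univ.filter fun q : Pd n => (Fin.snoc q 2 : Pd (n + 1)) ∈ Bu) \ (univ.filter fun q : Pd n => (Fin.snoc q 0 : Pd (n + 1)) ∈ Bu)).card + ((univ.filter fun q : Pd n => (Fin.snoc q 2 : Pd (n + 1)) ∈ Cu) \ (univ.filter fun q : Pd n => (Fin.snoc q 0 : Pd (n + 1)) ∈ Cu)).card) = k → 2 * sStarD (univ.filter fun q : Pd n => (Fin.snoc q 2 : Pd (n + 1)) ∈ Au) (univ.filter fun q : Pd n => (Fin.snoc q 2 : Pd (n + 1)) ∈ Bu) (univ.filter fun q : Pd n => (Fin.snoc q 2 : Pd (n + 1)) ∈ Cu) ≤ sStarD Au Bu Cu := by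
  induction k using Nat.strong_induction_on with
  | _ k IH =>
  intro Au Bu Cu hA hB hC hAu hBu hCu haA haB haC hk
  -- generic facts
  have sub0 : ∀ (Xu : Finset (Pd (n + 1))), IsUpperSet (Xu : Set (Pd (n + 1))) → ∀ q : Pd n, (Fin.snoc q 0 : Pd (n + 1)) ∈ Xu → (Fin.snoc q 2 : Pd (n + 1)) ∈ Xu :=
    fun Xu hX q h => hX (snoc_le_snoc_of_le q (by decide : (0:Fin 3) ≤ 2)) h
  -- STEP for the first slot: if its increment is nonempty we can reduce
  have step : ∀ (Au Bu Cu : Finset (Pd (n + 1))), IsUpperSet (((Au : Finset (Pd (n + 1)))) : Set (Pd (n + 1))) → IsUpperSet (((Bu : Finset (Pd (n + 1)))) : Set (Pd (n + 1))) → IsUpperSet (((Cu : Finset (Pd (n + 1)))) : Set (Pd (n + 1))) → (∀ q : Pd n, ind Au (Fin.snoc q 1 : Pd (n + 1)) = ind Au (Fin.snoc q 2 : Pd (n + 1))) → (∀ q : Pd n, ind Bu (Fin.snoc q 1 : Pd (n + 1)) = ind Bu (Fin.snoc q 2 : Pd (n + 1))) → (∀ q : Pd n, ind Cu (Fin.snoc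 q 1 : Pd (n + 1)) = ind Cu (Fin.snoc q 2 : Pd (n + 1))) →
      (∀ p ∈ ((univ.filter fun q : Pd n => (Fin.snoc q 2 : Pd (n + 1)) ∈ Au) \ (univ.filter fun q : Pd n => (Fin.snoc q 0 : Pd (n + 1)) ∈ Au)), ∀ q ∈ ((univ.filter fun q : Pd n => (Fin.snoc q 2 : Pd (n + 1)) ∈ Au) \ (univ.filter fun q : Pd n => (Fin.snoc q 0 : Pd (n + 1)) ∈ Au)), p ≤ q → p = q) → (∀ p ∈ ((univ.filter fun q : Pd n => (Fin.snoc q 2 : Pd (n + 1)) ∈ Bu) \ (univ.filter fun q : Pd n => (Fin.snoc q 0 : Pd (n + 1)) ∈ Bu)), ∀ q ∈ ((univ.filter fun q : Pd n => (Fin.snoc q 2 : Pd (n + 1)) ∈ Bu) \ (univ.filter fun q : Pd n => (Fin.snoc q 0 : Pd (n + 1)) ∈ Bu)), p ≤ q → p = q) → (∀ p ∈ ((univ.filter fun q : Pd n => (Fin.snoc q 2 : Pd (n + 1)) ∈ Cu) \ (univ.filter fun q : Pd n => (Fin.snoc q 0 : Pd (n + 1)) ∈ Cu)), ∀ q ∈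 ((univ.filter fun q : Pd n => (Fin.snoc q 2 : Pd (n + 1)) ∈ Cu) \ (univ.filter fun q : Pd n => (Fin.snoc q 0 : Pd (n + 1)) ∈ Cu)), p ≤ q → p = q) → (((univ.filter fun q : Pd n => (Fin.snoc q 2 : Pd (n + 1)) ∈ Au) \ (univ.filter fun q : Pd n => (Fin.snoc q 0 : Pd (n + 1)) ∈ Au)).card + ((univ.filter fun q : Pd n => (Fin.snoc q 2 : Pd (n + 1)) ∈ Bu) \ (univ.filter fun q : Pd n => (Fin.snoc q 0 : Pd (n + 1)) ∈ Bu)).card + ((univ.filter fun q : Pd n => (Fin.snoc q 2 : Pd (n + 1)) ∈ Cu) \ (univ.filter fun q : Pd n => (Fin.snoc q 0 : Pd (n + 1)) ∈ Cu)).card) = k → ((univ.filter fun q : Pd n => (Fin.snoc q 2 : Pd (n + 1)) ∈ Au) \ (univ.filter fun q : Pd n => (Fin.snoc q 0 : Pd (n + 1)) ∈ Au)).Nonempty → 2 * sStarD (univ.filter fun q : Pd n => (Fin.snoc q 2 : Pd (n + 1)) ∈ Au) (univ.filter fun q : Pd n => (Fin.snoc q 2 : Pd (n + 1)) ∈ Bu)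 (univ.filter fun q : Pd n => (Fin.snoc q 2 : Pd (n + 1)) ∈ Cu) ≤ sStarD Au Bu Cu := by
    intro Au Bu Cu hA hB hC hAu hBu hCu haA haB haC hk hne
    obtain ⟨w, hw⟩ := hne
    have hw2 : (Fin.snoc w 2 : Pd (n + 1)) ∈ Au := (mem_filter.1 (Finset.mem_sdiff.1 hw).1).2
    have hw0 : (Fin.snoc w 0 : Pd (n + 1)) ∉ Au := fun h => (Finset.mem_sdiff.1 hw).2 (mem_filter.2 ⟨mem_univ _, h⟩)
    -- antichain ⟹ every comparable top point other than w is a bottom point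
    have hcomp : ∀ q : Pd n, (q ≤ w ∨ w ≤ q) → q ≠ w → (Fin.snoc q 2 : Pd (n + 1)) ∈ Au → (Fin.snoc q 0 : Pd (n + 1)) ∈ Au := by
      intro q hqw hne hq2
      by_contra hq0
      have hq : q ∈ ((univ.filter fun q : Pd n => (Fin.snoc q 2 : Pd (n + 1)) ∈ Au) \ (univ.filter fun q : Pd n => (Fin.snoc q 0 : Pd (n + 1)) ∈ Au)) := Finset.mem_sdiff.2 ⟨mem_filter.2 ⟨mem_univ _, hq2⟩, fun h => hq0 (mem_filter.1 h).2⟩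
      rcases hqw with hqw | hqw
      · exact hne (haA q hq w hw hqw)
      · exact hne (haA w hw q hq hqw).symm
    by_cases hwBC : (Fin.snoc w 0 : Pd (n + 1)) ∈ Bu ∧ (Fin.snoc w 0 : Pd (n + 1)) ∈ Cu
    · -- R′ : delete (w,1),(w,2) from Au
      have hwB2 := sub0 Bu hB w hwBC.1
      have hwC2 := sub0 Cu hC w hwBC.2
      have hR := slack_erase_top_le Au Bu Cu w hB hC hAu hBu hCu hw2 hwB2 hwC2
      have hA' := isUpperSet_erase_top Au w hA hw0 (fun q h1 h2 h3 => hcomp q (Or.inl h1) h2 h3)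
      have hAu' := upperStep_erase_top Au w hAu
      have e2 := filter_two_erase_top Au w
      have e0 := filter_zero_erase_top Au w
      have einc : ((univ.filter fun q : Pd n => (Fin.snoc q 2 : Pd (n + 1)) ∈ ((Au.erase (Fin.snoc w 1 : Pd (n + 1))).erase (Fin.snoc w 2 : Pd (n + 1)))) \ (univ.filter fun q : Pd n => (Fin.snoc q 0 : Pd (n + 1)) ∈ ((Au.erase (Fin.snoc w 1 : Pd (n + 1))).erase (Fin.snoc w 2 : Pd (n + 1))))) = (((univ.filter fun q : Pd n => (Fin.snoc q 2 : Pd (n + 1)) ∈ Au) \ (univ.filter fun q : Pd n => (Fin.snoc q 0 : Pd (n + 1)) ∈ Au))).erase w := by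
        rw [e2, e0]; ext q; simp only [Finset.mem_sdiff, Finset.mem_erase, mem_filter, mem_univ, true_and]; tauto
      have hlt : ((((univ.filter fun q : Pd n => (Fin.snoc q 2 : Pd (n + 1)) ∈ Au) \ (univ.filter fun q : Pd n => (Fin.snoc q 0 : Pd (n + 1)) ∈ Au))).erase w).card + ((univ.filter fun q : Pd n => (Fin.snoc q 2 : Pd (n + 1)) ∈ Bu) \ (univ.filter fun q : Pd n => (Fin.snoc q 0 : Pd (n + 1)) ∈ Bu)).card + ((univ.filter fun q : Pd n => (Fin.snoc q 2 : Pd (n + 1)) ∈ Cu) \ (univ.filter fun q : Pd n => (Fin.snoc q 0 : Pd (n + 1)) ∈ Cu)).card < k := by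
        have := Finset.card_erase_lt_of_mem hw; omega
      have haA' : ∀ p ∈ (((univ.filter fun q : Pd n => (Fin.snoc q 2 : Pd (n + 1)) ∈ Au) \ (univ.filter fun q : Pd n => (Fin.snoc q 0 : Pd (n + 1)) ∈ Au))).erase w, ∀ q ∈ (((univ.filter fun q : Pd n => (Fin.snoc q 2 : Pd (n + 1)) ∈ Au) \ (univ.filter fun q : Pd n => (Fin.snoc q 0 : Pd (n + 1)) ∈ Au))).erase w, p ≤ q → p = q :=
        fun p hp q hq hpq => haA p (Finset.mem_of_mem_erase hp) q (Finset.mem_of_mem_erase hq) hpq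
      have ih := IH _ hlt ((Au.erase (Fin.snoc w 1 : Pd (n + 1))).erase (Fin.snoc w 2 : Pd (n + 1))) Bu Cu hA' hB hC hAu' hBu hCu (by rw [einc]; exact haA') haB haC (by rw [einc])
      rw [e2] at ih
      linarith
    · -- R : add (w,0) to Au
      have hR0 := sStarD_insert_bottom_le Bu Cu Au w hB hC hBu hCu hAu hw0 hwBC
      have hR : sStarD (insert (Fin.snoc w 0 : Pd (n + 1)) Au) Bu Cu ≤ sStarD Au Bu Cu := by
        rw [sStarD_swap23 Bu Cu (insert (Fin.snoc w 0 : Pd (n + 1)) Au), sStarD_swap12 Bu (insert (Fin.snoc w 0 : Pd (n + 1)) Au) Cu, sStarD_swap23 Bu Cu Au, sStarD_swap12 Bu Au Cu] at hR0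
        exact hR0
      have hA' := isUpperSet_insert_bottom Au w hA hAu hw2 (fun q h1 h2 h3 => hcomp q (Or.inr h1) h2 h3)
      have hAu' := upperStep_insert_bottom Au w hAu
      have e2 := filter_two_insert_bottom Au w
      have e0 := filter_zero_insert_bottom Au w
      have hw0f : w ∉ (univ.filter fun q : Pd n => (Fin.snoc q 0 : Pd (n + 1)) ∈ Au) := fun h => hw0 (mem_filter.1 h).2
      have einc : ((univ.filter fun q : Pd n => (Fin.snoc q 2 : Pd (n + 1)) ∈ (insert (Fin.snoc w 0 : Pd (n + 1)) Au)) \ (univ.filter fun q : Pd n => (Fin.snoc q 0 : Pd (n + 1)) ∈ (insert (Fin.snoc w 0 : Pd (n + 1)) Au))) = (((univ.filter fun q : Pd n => (Fin.snoc q 2 : Pd (n + 1)) ∈ Au) \ (univ.filter fun q : Pd n => (Fin.snoc q 0 : Pd (n + 1)) ∈ Au))).erase w := by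
        rw [e2, e0]; ext q; simp only [Finset.mem_sdiff, Finset.mem_erase, mem_insert, mem_filter, mem_univ, true_and]; tauto
      have hlt : ((((univ.filter fun q : Pd n => (Fin.snoc q 2 : Pd (n + 1)) ∈ Au) \ (univ.filter fun q : Pd n => (Fin.snoc q 0 : Pd (n + 1)) ∈ Au))).erase w).card + ((univ.filter fun q : Pd n => (Fin.snoc q 2 : Pd (n + 1)) ∈ Bu) \ (univ.filter fun q : Pd n => (Fin.snoc q 0 : Pd (n + 1)) ∈ Bu)).card + ((univ.filter fun q : Pd n => (Fin.snoc q 2 : Pd (n + 1)) ∈ Cu) \ (univ.filter fun q : Pd n => (Fin.snoc q 0 : Pd (n + 1)) ∈ Cu)).card < k := by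
        have := Finset.card_erase_lt_of_mem hw; omega
      have haA' : ∀ p ∈ (((univ.filter fun q : Pd n => (Fin.snoc q 2 : Pd (n + 1)) ∈ Au) \ (univ.filter fun q : Pd n => (Fin.snoc q 0 : Pd (n + 1)) ∈ Au))).erase w, ∀ q ∈ (((univ.filter fun q : Pd n => (Fin.snoc q 2 : Pd (n + 1)) ∈ Au) \ (univ.filter fun q : Pd n => (Fin.snoc q 0 : Pd (n + 1)) ∈ Au))).erase w, p ≤ q → p = q :=
        fun p hp q hq hpq => haA p (Finset.mem_of_mem_erase hp) q (Finset.mem_of_mem_erase hq) hpq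
      have ih := IH _ hlt (insert (Fin.snoc w 0 : Pd (n + 1)) Au) Bu Cu hA' hB hC hAu' hBu hCu (by rw [einc]; exact haA') haB haC (by rw [einc])
      rw [e2] at ih
      linarith
  -- MAIN: find a nonempty increment or conclude by the two-cylinder face
  by_cases hneA : ((univ.filter fun q : Pd n => (Fin.snoc q 2 : Pd (n + 1)) ∈ Au) \ (univ.filter fun q : Pd n => (Fin.snoc q 0 : Pd (n + 1)) ∈ Au)).Nonempty
  · exact step Au Bu Cu hA hB hC hAu hBu hCu haA haB haC hk hneA
  by_cases hneB : ((univ.filter fun q : Pd n => (Fin.snoc q 2 : Pd (n + 1)) ∈ Bu) \ (univ.filter fun q : Pd n => (Fin.snoc q 0 : Pd (n + 1)) ∈ Bu)).Nonempty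
  · have h := step Bu Au Cu hB hA hC hBu hAu hCu haB haA haC (by omega) hneB
    rw [sStarD_swap12 Bu Au Cu, sStarD_swap12 (univ.filter fun q : Pd n => (Fin.snoc q 2 : Pd (n + 1)) ∈ Bu) (univ.filter fun q : Pd n => (Fin.snoc q 2 : Pd (n + 1)) ∈ Au) (univ.filter fun q : Pd n => (Fin.snoc q 2 : Pd (n + 1)) ∈ Cu)] at h
    exact h
  by_cases hneC : ((univ.filter fun q : Pd n => (Fin.snoc q 2 : Pd (n + 1)) ∈ Cu) \ (univ.filter fun q : Pd n => (Fin.snoc q 0 : Pd (n + 1)) ∈ Cu)).Nonempty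
  · have h := step Cu Au Bu hC hA hB hCu hAu hBu haC haA haB (by omega) hneC
    rw [sStarD_swap12 Cu Au Bu, sStarD_swap23 Au Cu Bu, sStarD_swap12 (univ.filter fun q : Pd n => (Fin.snoc q 2 : Pd (n + 1)) ∈ Cu) (univ.filter fun q : Pd n => (Fin.snoc q 2 : Pd (n + 1)) ∈ Au) (univ.filter fun q : Pd n => (Fin.snoc q 2 : Pd (n + 1)) ∈ Bu), sStarD_swap23 (univ.filter fun q : Pd n => (Fin.snoc q 2 : Pd (n + 1)) ∈ Au) (univ.filter fun q : Pd n => (Fin.snoc q 2 : Pd (n + 1)) ∈ Cu) (univ.filter fun q : Pd n => (Fin.snoc q 2 : Pd (n + 1)) ∈ Bu)] at h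
    exact h
  -- all increments empty: A and B are cylinders
  rw [Finset.not_nonempty_iff_eq_empty] at hneA hneB
  have cylA : ∀ q : Pd n, ind Au (Fin.snoc q 0 : Pd (n + 1)) = ind Au (Fin.snoc q 2 : Pd (n + 1)) := by
    intro q; unfold ind
    by_cases h2 : (Fin.snoc q 2 : Pd (n + 1)) ∈ Au
    · have h0 : (Fin.snoc q 0 : Pd (n + 1)) ∈ Au := by
        by_contra h0
        have : q ∈ ((univ.filter fun q : Pd n => (Fin.snoc q 2 : Pd (n + 1)) ∈ Au) \ (univ.filter fun q : Pd n => (Fin.snoc q 0 : Pd (n + 1)) ∈ Au)) := Finset.mem_sdiff.2 ⟨mem_filter.2 ⟨mem_univ _, h2⟩, fun h => h0 (mem_filter.1 h).2⟩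
        rw [hneA] at this; exact absurd this (by simp)
      rw [if_pos h0, if_pos h2]
    · have h0 : (Fin.snoc q 0 : Pd (n + 1)) ∉ Au := fun h => h2 (sub0 Au hA q h)
      rw [if_neg h0, if_neg h2]
  have cylB : ∀ q : Pd n, ind Bu (Fin.snoc q 0 : Pd (n + 1)) = ind Bu (Fin.snoc q 2 : Pd (n + 1)) := by
    intro q; unfold ind
    by_cases h2 : (Fin.snoc q 2 : Pd (n + 1)) ∈ Bu
    · have h0 : (Fin.snoc q 0 : Pd (n + 1)) ∈ Bu := by
        by_contra h0
        have : q ∈ ((univ.filter fun q : Pd n => (Fin.snoc q 2 : Pd (n + 1)) ∈ Bu) \ (univ.filter fun q : Pd n => (Fin.snoc q 0 : Pd (n + 1)) ∈ Bu)) := Finset.mem_sdiff.2 ⟨mem_filter.2 ⟨mem_univ _, h2⟩, fun h => h0 (mem_filter.1 h).2⟩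
        rw [hneB] at this; exact absurd this (by simp)
      rw [if_pos h0, if_pos h2]
    · have h0 : (Fin.snoc q 0 : Pd (n + 1)) ∉ Bu := fun h => h2 (sub0 Bu hB q h)
      rw [if_neg h0, if_neg h2]
  exact two_mul_sStarD_top_le_of_upperStep_twoCylinders Au Bu Cu hAu hBu hCu cylA cylB
    (hP _ _ _ (isUpperSet_filter_snoc hA 2) (isUpperSet_filter_snoc hB 2) (isUpperSet_filter_snoc hC 2))
    (hP _ _ _ (isUpperSet_filter_snoc hA 0) (isUpperSet_filter_snoc hB 0) (isUpperSet_filter_snoc hC 0))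

/-- **COMB-M⁺ WHEN TWO OF THE THREE INCREMENTS ARE ANTICHAINS** (every `n`; the third slot is arbitrary).  Given `PatternPos n` (hypothesis `hP`): for every
upper-step triple of up-sets `Au, Bu, Cu ⊆ [3]^{n+1}` whose increments `A²∖A⁰` and `B²∖B⁰` are antichains (e.g. `A` and `B` each lowered by some of their minimal
generators, `C` lowered arbitrarily), `2·sStarD(A²,B²,C²) ≤ sStarD Au Bu Cu`.  Proof: the R / R′ moves act on one slot at a time and empty an antichain increment
completely; once `a = b = ∅` the sets `A, B` are cylinders and the two-cylinder face applies. [this work] -/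
theorem two_mul_sStarD_top_le_of_two_antichain_increments (hP : ∀ X Y Z : Finset (Pd n), IsUpperSet (X : Set (Pd n)) → IsUpperSet (Y : Set (Pd n)) → IsUpperSet (Z : Set (Pd n)) → 0 ≤ sStarD X Y Z) (k : ℕ) :
    ∀ Au Bu Cu : Finset (Pd (n + 1)), IsUpperSet (((Au : Finset (Pd (n + 1)))) : Set (Pd (n + 1))) → IsUpperSet (((Bu : Finset (Pd (n + 1)))) : Set (Pd (n + 1))) → IsUpperSet (((Cu : Finset (Pd (n + 1)))) : Set (Pd (n + 1))) → (∀ q : Pd n, ind Au (Fin.snoc q 1 : Pd (n + 1)) = ind Au (Fin.snoc q 2 : Pd (n + 1))) → (∀ q : Pd n, ind Bu (Fin.snoc q 1 : Pd (n + 1)) = ind Bu (Fin.snoc q 2 : Pd (n + 1))) → (∀ q : Pd n, ind Cu (Fin.snoc q 1 : Pd (n + 1)) = ind Cu (Fin.snoc q 2 : Pd (n + 1))) →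
      (∀ p ∈ ((univ.filter fun q : Pd n => (Fin.snoc q 2 : Pd (n + 1)) ∈ Au) \ (univ.filter fun q : Pd n => (Fin.snoc q 0 : Pd (n + 1)) ∈ Au)), ∀ q ∈ ((univ.filter fun q : Pd n => (Fin.snoc q 2 : Pd (n + 1)) ∈ Au) \ (univ.filter fun q : Pd n => (Fin.snoc q 0 : Pd (n + 1)) ∈ Au)), p ≤ q → p = q) → (∀ p ∈ ((univ.filter fun q : Pd n => (Fin.snoc q 2 : Pd (n + 1)) ∈ Bu) \ (univ.filter fun q : Pd n => (Fin.snoc q 0 : Pd (n + 1)) ∈ Bu)), ∀ q ∈ ((univ.filter fun q : Pd n => (Fin.snoc q 2 : Pd (n + 1)) ∈ Bu) \ (univ.filter fun q : Pd n => (Fin.snoc q 0 : Pd (n + 1)) ∈ Bu)), p ≤ q → p = q) →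
      (((univ.filter fun q : Pd n => (Fin.snoc q 2 : Pd (n + 1)) ∈ Au) \ (univ.filter fun q : Pd n => (Fin.snoc q 0 : Pd (n + 1)) ∈ Au)).card + ((univ.filter fun q : Pd n => (Fin.snoc q 2 : Pd (n + 1)) ∈ Bu) \ (univ.filter fun q : Pd n => (Fin.snoc q 0 : Pd (n + 1)) ∈ Bu)).card) = k → 2 * sStarD (univ.filter fun q : Pd n => (Fin.snoc q 2 : Pd (n + 1)) ∈ Au) (univ.filter fun q : Pd n => (Fin.snoc q 2 : Pd (n + 1)) ∈ Bu) (univ.filter fun q : Pd n => (Fin.snoc q 2 : Pd (n + 1)) ∈ Cu) ≤ sStarD Au Bu Cu := by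
  induction k using Nat.strong_induction_on with
  | _ k IH =>
  intro Au Bu Cu hA hB hC hAu hBu hCu haA haB hk
  have sub0 : ∀ (Xu : Finset (Pd (n + 1))), IsUpperSet (Xu : Set (Pd (n + 1))) → ∀ q : Pd n, (Fin.snoc q 0 : Pd (n + 1)) ∈ Xu → (Fin.snoc q 2 : Pd (n + 1)) ∈ Xu :=
    fun Xu hX q h => hX (snoc_le_snoc_of_le q (by decide : (0:Fin 3) ≤ 2)) h
  have step : ∀ (Au Bu Cu : Finset (Pd (n + 1))), IsUpperSet (((Au : Finset (Pd (n + 1)))) : Set (Pd (n + 1))) → IsUpperSet (((Bu : Finset (Pd (n + 1)))) : Set (Pd (n + 1))) → IsUpperSet (((Cu : Finset (Pd (n + 1)))) : Set (Pd (n + 1))) → (∀ q : Pd n, ind Au (Fin.snoc q 1 : Pd (n + 1)) = ind Au (Fin.snoc q 2 : Pd (n + 1))) → (∀ q : Pd n, ind Bu (Fin.snoc q 1 : Pd (n + 1)) = ind Bu (Fin.snoc q 2 : Pd (n + 1))) → (∀ q : Pd n, ind Cu (Fin.snoc q 1 : Pd (n + 1)) = ind Cu (Fin.snoc q 2 : Pd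 (n + 1))) →
      (∀ p ∈ ((univ.filter fun q : Pd n => (Fin.snoc q 2 : Pd (n + 1)) ∈ Au) \ (univ.filter fun q : Pd n => (Fin.snoc q 0 : Pd (n + 1)) ∈ Au)), ∀ q ∈ ((univ.filter fun q : Pd n => (Fin.snoc q 2 : Pd (n + 1)) ∈ Au) \ (univ.filter fun q : Pd n => (Fin.snoc q 0 : Pd (n + 1)) ∈ Au)), p ≤ q → p = q) → (∀ p ∈ ((univ.filter fun q : Pd n => (Fin.snoc q 2 : Pd (n + 1)) ∈ Bu) \ (univ.filter fun q : Pd n => (Fin.snoc q 0 : Pd (n + 1)) ∈ Bu)), ∀ q ∈ ((univ.filter fun q : Pd n => (Fin.snoc q 2 : Pd (n + 1)) ∈ Bu) \ (univ.filter fun q : Pd n => (Fin.snoc q 0 : Pd (n + 1)) ∈ Bu)), p ≤ q → p = q) → (((univ.filter fun q : Pd n => (Fin.snoc q 2 : Pd (n + 1)) ∈ Au) \ (univ.filter fun q : Pd n => (Fin.snoc q 0 : Pd (n + 1)) ∈ Au)).card + ((univ.filter fun q : Pd n => (Fin.snoc q 2 : Pd (n + 1)) ∈ Bu) \ (univ.filter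 fun q : Pd n => (Fin.snoc q 0 : Pd (n + 1)) ∈ Bu)).card) = k → ((univ.filter fun q : Pd n => (Fin.snoc q 2 : Pd (n + 1)) ∈ Au) \ (univ.filter fun q : Pd n => (Fin.snoc q 0 : Pd (n + 1)) ∈ Au)).Nonempty → 2 * sStarD (univ.filter fun q : Pd n => (Fin.snoc q 2 : Pd (n + 1)) ∈ Au) (univ.filter fun q : Pd n => (Fin.snoc q 2 : Pd (n + 1)) ∈ Bu) (univ.filter fun q : Pd n => (Fin.snoc q 2 : Pd (n + 1)) ∈ Cu) ≤ sStarD Au Bu Cu := by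
    intro Au Bu Cu hA hB hC hAu hBu hCu haA haB hk hne
    obtain ⟨w, hw⟩ := hne
    have hw2 : (Fin.snoc w 2 : Pd (n + 1)) ∈ Au := (mem_filter.1 (Finset.mem_sdiff.1 hw).1).2
    have hw0 : (Fin.snoc w 0 : Pd (n + 1)) ∉ Au := fun h => (Finset.mem_sdiff.1 hw).2 (mem_filter.2 ⟨mem_univ _, h⟩)
    have hcomp : ∀ q : Pd n, (q ≤ w ∨ w ≤ q) → q ≠ w → (Fin.snoc q 2 : Pd (n + 1)) ∈ Au → (Fin.snoc q 0 : Pd (n + 1)) ∈ Au := by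
      intro q hqw hne hq2
      by_contra hq0
      have hq : q ∈ ((univ.filter fun q : Pd n => (Fin.snoc q 2 : Pd (n + 1)) ∈ Au) \ (univ.filter fun q : Pd n => (Fin.snoc q 0 : Pd (n + 1)) ∈ Au)) := Finset.mem_sdiff.2 ⟨mem_filter.2 ⟨mem_univ _, hq2⟩, fun h => hq0 (mem_filter.1 h).2⟩
      rcases hqw with hqw | hqw
      · exact hne (haA q hq w hw hqw)
      · exact hne (haA w hw q hq hqw).symm
    by_cases hwBC : (Fin.snoc w 0 : Pd (n + 1)) ∈ Bu ∧ (Fin.snoc w 0 : Pd (n + 1)) ∈ Cu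
    · have hwB2 := sub0 Bu hB w hwBC.1
      have hwC2 := sub0 Cu hC w hwBC.2
      have hR := slack_erase_top_le Au Bu Cu w hB hC hAu hBu hCu hw2 hwB2 hwC2
      have hA' := isUpperSet_erase_top Au w hA hw0 (fun q h1 h2 h3 => hcomp q (Or.inl h1) h2 h3)
      have hAu' := upperStep_erase_top Au w hAu
      have e2 := filter_two_erase_top Au w
      have e0 := filter_zero_erase_top Au w
      have einc : ((univ.filter fun q : Pd n => (Fin.snoc q 2 : Pd (n + 1)) ∈ ((Au.erase (Fin.snoc w 1 : Pd (n + 1))).erase (Fin.snoc w 2 : Pd (n + 1)))) \ (univ.filter fun q : Pd n => (Fin.snoc q 0 : Pd (n + 1)) ∈ ((Au.erase (Fin.snoc w 1 : Pd (n + 1))).erase (Fin.snoc w 2 : Pd (n + 1))))) = (((univ.filter fun q : Pd n => (Fin.snoc q 2 : Pd (n + 1)) ∈ Au) \ (univ.filter fun q : Pd n => (Fin.snoc q 0 : Pd (n + 1)) ∈ Au))).erase w := by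
        rw [e2, e0]; ext q; simp only [Finset.mem_sdiff, Finset.mem_erase, mem_filter, mem_univ, true_and]; tauto
      have hlt : ((((univ.filter fun q : Pd n => (Fin.snoc q 2 : Pd (n + 1)) ∈ Au) \ (univ.filter fun q : Pd n => (Fin.snoc q 0 : Pd (n + 1)) ∈ Au))).erase w).card + ((univ.filter fun q : Pd n => (Fin.snoc q 2 : Pd (n + 1)) ∈ Bu) \ (univ.filter fun q : Pd n => (Fin.snoc q 0 : Pd (n + 1)) ∈ Bu)).card < k := by
        have := Finset.card_erase_lt_of_mem hw; omega
      have haA' : ∀ p ∈ (((univ.filter fun q : Pd n => (Fin.snoc q 2 : Pd (n + 1)) ∈ Au) \ (univ.filter fun q : Pd n => (Fin.snoc q 0 : Pd (n + 1)) ∈ Au))).erase w, ∀ q ∈ (((univ.filter fun q : Pd n => (Fin.snoc q 2 : Pd (n + 1)) ∈ Au) \ (univ.filter fun q : Pd n => (Fin.snoc q 0 : Pd (n + 1)) ∈ Au))).erase w, p ≤ q → p = q :=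
        fun p hp q hq hpq => haA p (Finset.mem_of_mem_erase hp) q (Finset.mem_of_mem_erase hq) hpq
      have ih := IH _ hlt ((Au.erase (Fin.snoc w 1 : Pd (n + 1))).erase (Fin.snoc w 2 : Pd (n + 1))) Bu Cu hA' hB hC hAu' hBu hCu (by rw [einc]; exact haA') haB (by rw [einc])
      rw [e2] at ih
      linarith
    · have hR0 := sStarD_insert_bottom_le Bu Cu Au w hB hC hBu hCu hAu hw0 hwBC
      have hR : sStarD (insert (Fin.snoc w 0 : Pd (n + 1)) Au) Bu Cu ≤ sStarD Au Bu Cu := by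
        rw [sStarD_swap23 Bu Cu (insert (Fin.snoc w 0 : Pd (n + 1)) Au), sStarD_swap12 Bu (insert (Fin.snoc w 0 : Pd (n + 1)) Au) Cu, sStarD_swap23 Bu Cu Au, sStarD_swap12 Bu Au Cu] at hR0
        exact hR0
      have hA' := isUpperSet_insert_bottom Au w hA hAu hw2 (fun q h1 h2 h3 => hcomp q (Or.inr h1) h2 h3)
      have hAu' := upperStep_insert_bottom Au w hAu
      have e2 := filter_two_insert_bottom Au w
      have e0 := filter_zero_insert_bottom Au w
      have einc : ((univ.filter fun q : Pd n => (Fin.snoc q 2 : Pd (n + 1)) ∈ (insert (Fin.snoc w 0 : Pd (n + 1)) Au)) \ (univ.filter fun q : Pd n => (Fin.snoc q 0 : Pd (n + 1)) ∈ (insert (Fin.snoc w 0 : Pd (n + 1)) Au))) = (((univ.filter fun q : Pd n => (Fin.snoc q 2 : Pd (n + 1)) ∈ Au) \ (univ.filter fun q : Pd n => (Fin.snoc q 0 : Pd (n + 1)) ∈ Au))).erase w := by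
        rw [e2, e0]; ext q; simp only [Finset.mem_sdiff, Finset.mem_erase, mem_insert, mem_filter, mem_univ, true_and]; tauto
      have hlt : ((((univ.filter fun q : Pd n => (Fin.snoc q 2 : Pd (n + 1)) ∈ Au) \ (univ.filter fun q : Pd n => (Fin.snoc q 0 : Pd (n + 1)) ∈ Au))).erase w).card + ((univ.filter fun q : Pd n => (Fin.snoc q 2 : Pd (n + 1)) ∈ Bu) \ (univ.filter fun q : Pd n => (Fin.snoc q 0 : Pd (n + 1)) ∈ Bu)).card < k := by
        have := Finset.card_erase_lt_of_mem hw; omega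
      have haA' : ∀ p ∈ (((univ.filter fun q : Pd n => (Fin.snoc q 2 : Pd (n + 1)) ∈ Au) \ (univ.filter fun q : Pd n => (Fin.snoc q 0 : Pd (n + 1)) ∈ Au))).erase w, ∀ q ∈ (((univ.filter fun q : Pd n => (Fin.snoc q 2 : Pd (n + 1)) ∈ Au) \ (univ.filter fun q : Pd n => (Fin.snoc q 0 : Pd (n + 1)) ∈ Au))).erase w, p ≤ q → p = q :=
        fun p hp q hq hpq => haA p (Finset.mem_of_mem_erase hp) q (Finset.mem_of_mem_erase hq) hpq
      have ih := IH _ hlt (insert (Fin.snoc w 0 : Pd (n + 1)) Au) Bu Cu hA' hB hC hAu' hBu hCu (by rw [einc]; exact haA') haB (by rw [einc])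
      rw [e2] at ih
      linarith
  by_cases hneA : ((univ.filter fun q : Pd n => (Fin.snoc q 2 : Pd (n + 1)) ∈ Au) \ (univ.filter fun q : Pd n => (Fin.snoc q 0 : Pd (n + 1)) ∈ Au)).Nonempty
  · exact step Au Bu Cu hA hB hC hAu hBu hCu haA haB hk hneA
  by_cases hneB : ((univ.filter fun q : Pd n => (Fin.snoc q 2 : Pd (n + 1)) ∈ Bu) \ (univ.filter fun q : Pd n => (Fin.snoc q 0 : Pd (n + 1)) ∈ Bu)).Nonempty
  · have h := step Bu Au Cu hB hA hC hBu hAu hCu haB haA (by omega) hneB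
    rw [sStarD_swap12 Bu Au Cu, sStarD_swap12 (univ.filter fun q : Pd n => (Fin.snoc q 2 : Pd (n + 1)) ∈ Bu) (univ.filter fun q : Pd n => (Fin.snoc q 2 : Pd (n + 1)) ∈ Au) (univ.filter fun q : Pd n => (Fin.snoc q 2 : Pd (n + 1)) ∈ Cu)] at h
    exact h
  rw [Finset.not_nonempty_iff_eq_empty] at hneA hneB
  have cylA : ∀ q : Pd n, ind Au (Fin.snoc q 0 : Pd (n + 1)) = ind Au (Fin.snoc q 2 : Pd (n + 1)) := by
    intro q; unfold ind
    by_cases h2 : (Fin.snoc q 2 : Pd (n + 1)) ∈ Au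
    · have h0 : (Fin.snoc q 0 : Pd (n + 1)) ∈ Au := by
        by_contra h0
        have : q ∈ ((univ.filter fun q : Pd n => (Fin.snoc q 2 : Pd (n + 1)) ∈ Au) \ (univ.filter fun q : Pd n => (Fin.snoc q 0 : Pd (n + 1)) ∈ Au)) := Finset.mem_sdiff.2 ⟨mem_filter.2 ⟨mem_univ _, h2⟩, fun h => h0 (mem_filter.1 h).2⟩
        rw [hneA] at this; exact absurd this (by simp)
      rw [if_pos h0, if_pos h2]
    · have h0 : (Fin.snoc q 0 : Pd (n + 1)) ∉ Au := fun h => h2 (sub0 Au hA q h)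
      rw [if_neg h0, if_neg h2]
  have cylB : ∀ q : Pd n, ind Bu (Fin.snoc q 0 : Pd (n + 1)) = ind Bu (Fin.snoc q 2 : Pd (n + 1)) := by
    intro q; unfold ind
    by_cases h2 : (Fin.snoc q 2 : Pd (n + 1)) ∈ Bu
    · have h0 : (Fin.snoc q 0 : Pd (n + 1)) ∈ Bu := by
        by_contra h0
        have : q ∈ ((univ.filter fun q : Pd n => (Fin.snoc q 2 : Pd (n + 1)) ∈ Bu) \ (univ.filter fun q : Pd n => (Fin.snoc q 0 : Pd (n + 1)) ∈ Bu)) := Finset.mem_sdiff.2 ⟨mem_filter.2 ⟨mem_univ _, h2⟩, fun h => h0 (mem_filter.1 h).2⟩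
        rw [hneB] at this; exact absurd this (by simp)
      rw [if_pos h0, if_pos h2]
    · have h0 : (Fin.snoc q 0 : Pd (n + 1)) ∉ Bu := fun h => h2 (sub0 Bu hB q h)
      rw [if_neg h0, if_neg h2]
  exact two_mul_sStarD_top_le_of_upperStep_twoCylinders Au Bu Cu hAu hBu hCu cylA cylB
    (hP _ _ _ (isUpperSet_filter_snoc hA 2) (isUpperSet_filter_snoc hB 2) (isUpperSet_filter_snoc hC 2))
    (hP _ _ _ (isUpperSet_filter_snoc hA 0) (isUpperSet_filter_snoc hB 0) (isUpperSet_filter_snoc hC 0))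

end Summit.CriticalPhenomena.PercolationContinuityZ3.Theorems.SahiGridPattern
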